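import Summits.Ventures.HodgeRepro2.T5SplitUnitaryGroup
import Summits.Ventures.HodgeRepro2.T5SplitPlaceHecke
import Summits.Ventures.HodgeRepro2.T5UnitaryGroupForm

/-!
# `U(V_v) ≅ GL_n(F_v)` at a split place, as a group isomorphism carrying `K_v` onto `GL_n(𝒪_v)`; the spherical
Hecke algebra of the split unitary group is commutative (cell pub-hodge-repro2, seat p3)

Tier-5 N3 support (seat p8's T5-107 `T5SplitPlaceHecke.heckeAlgebra_mul_comm_of_equiv` takes «`e : G' ≃* GL ι F`
carrying `K'` onto `GL_n(R)`» as its hypothesis — «the form in which the record's `U(V_v) ≅ GL_n(F_v)`,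
`K_v ↦ GL_n(𝒪_v)` enters»; route/T4-B1-p3.md's «`U(V_v) ≅ GL₃(F⁺_v)` at a place `v` split in `E`»; row N2.2.2 /
§N2.7.2 of route/T5-N2-route-3.md). File 144 (`T5SplitUnitaryGroup`) showed that over the split local algebra
`F × F` with the swap involution (file 131's `swapStarRing`) the first projection is a multiplicative bijection
from the isometries of `H = (A, Aᵀ)` onto `GL_n(F)`. Here that bijection is packaged as the objects seat p8's
theorem consumes:
* `fstGL` — the first projection `GL_n(F × F) →* GL_n(F)` (Mathlib's `GeneralLinearGroup.map (RingHom.fst F F)`);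
* `mem_formUnitaryGroup_hermitianPair_iff` — membership in seat p8's `formUnitaryGroup (hermitianPair A)` for the
  swap star is `g₂ᵀ A g₁ = A`;
* `liftMatrix A g₁ = (g₁, (A g₁⁻¹ A⁻¹)ᵀ)`, the unique isometry over `g₁`, and **`splitUnitaryEquiv A hA :
  U((A, Aᵀ)) ≃* GL_n(F)`** (the first projection; `splitUnitaryEquiv_apply`, `coe_splitUnitaryEquiv_symm`);
* for `A = A₀` read from a matrix over `R` with `A₀ ∈ GL_n(R)` (`φ : R →+* F` any ring homomorphism): `splitHyperspecial` —
  the isometries with entries and inverse entries in `R × R` (`K_v = U(V_v) ∩ GL_n(𝒪_v × 𝒪_v)`),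
  **`splitUnitaryEquiv_mem_range_iff`** — `e g ∈ GL_n(R) ⟺ g ∈ K'`, i.e. the isomorphism carries `K_v` onto
  `GL_n(𝒪_v)` (a unimodular `A₀` makes the second component integral whenever the first is);
* **`heckeAlgebra_mul_comm_split`** — for `R` a DVR with finite residue field and `F` its fraction field,
  `H(U((A, Aᵀ)), K')` is COMMUTATIVE (seat p8's T5-107 applied to `splitUnitaryEquiv`): the split half of
  «`H(U(V_v), K_v)` is commutative» with NO hypothesis beyond `A₀ ∈ GL_n(R)`.
The transport to the record's own local algebra `K⁺_v ⊗ K ≅ K_w × K_w` (file 134's `splitEquiv`, carrying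
`1 ⊗ c` to the swap) is the next file's.

Mathlib + this seat's files 131 / 144 + seat p8's T5-107 (T5SplitPlaceHecke) / T5-124 (T5UnitaryGroupForm) and
their imports; no display; no device. §8(d): uses an L-value-free non-vanishing device: NO.
-/

namespace Summit.Ventures.HodgeRepro2.T5SplitUnitaryGroupEquiv

open Matrix Summit.Ventures.HodgeRepro2.T5SplitHermitianClass Summit.Ventures.HodgeRepro2.T5SplitUnitaryGroup
  Summit.Ventures.HodgeRepro2.T5UnitaryGroupForm

/-! ## The first projection and the isometry group of `(A, Aᵀ)` -/

section Equiv

variable {F : Type*} [CommRing F] {n : Type*} [Fintype n] [DecidableEq n]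

/-- The first projection `GL_n(F × F) →* GL_n(F)`. -/
abbrev fstGL : GL n (F × F) →* GL n F := Matrix.GeneralLinearGroup.map (RingHom.fst F F)

/-- The matrix of `fstGL g` is the first component of the matrix of `g`. -/
theorem coe_fstGL (g : GL n (F × F)) :
    ((fstGL g : GL n F) : Matrix n n F) = (g : Matrix n n (F × F)).map Prod.fst := rfl

/-- Membership in seat p8's `formUnitaryGroup (hermitianPair A)` for the swap star: `g₂ᵀ A g₁ = A`. -/
theorem mem_formUnitaryGroup_hermitianPair_iff (A : Matrix n n F) (g : GL n (F × F)) :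
    (letI := swapStarRing F; g ∈ formUnitaryGroup (hermitianPair A)) ↔
      ((g : Matrix n n (F × F)).map Prod.snd)ᵀ * A * (g : Matrix n n (F × F)).map Prod.fst = A := by
  letI := swapStarRing F
  rw [mem_formUnitaryGroup_iff]
  exact conjTranspose_mul_mul_eq_iff A g

variable (A : Matrix n n F)

/-- The unique isometry of `(A, Aᵀ)` over `g₁ ∈ GL_n(F)`: the matrix `(g₁, (A g₁⁻¹ A⁻¹)ᵀ)`. -/
noncomputable def liftMatrix (g₁ : Matrix n n F) : Matrix n n (F × F) := pairMatrix g₁ (A * g₁⁻¹ * A⁻¹)ᵀ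

/-- The first component of `liftMatrix A g₁` is `g₁`. -/
theorem liftMatrix_map_fst (g₁ : Matrix n n F) : (liftMatrix A g₁).map Prod.fst = g₁ :=
  pairMatrix_map_fst _ _

/-- The second component of `liftMatrix A g₁` is `(A g₁⁻¹ A⁻¹)ᵀ`. -/
theorem liftMatrix_map_snd (g₁ : Matrix n n F) : (liftMatrix A g₁).map Prod.snd = (A * g₁⁻¹ * A⁻¹)ᵀ :=
  pairMatrix_map_snd _ _

variable (hA : IsUnit A.det)

include hA in
/-- `liftMatrix A g₁` is invertible for `g₁` invertible. -/
theorem isUnit_det_liftMatrix {g₁ : Matrix n n F} (h₁ : IsUnit g₁.det) : IsUnit (liftMatrix A g₁).det := by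
  rw [isUnit_det_iff, liftMatrix_map_fst, liftMatrix_map_snd, det_transpose, det_mul, det_mul]
  exact ⟨h₁, (hA.mul (isUnit_nonsing_inv_det _ h₁)).mul (isUnit_nonsing_inv_det A hA)⟩

include hA in
/-- `liftMatrix A g₁` is an isometry of `(A, Aᵀ)` (file 144). -/
theorem liftMatrix_mem {g₁ : Matrix n n F} (h₁ : IsUnit g₁.det) :
    letI := swapStarRing F
    Matrix.GeneralLinearGroup.mk'' (liftMatrix A g₁) (isUnit_det_liftMatrix A hA h₁) ∈
      formUnitaryGroup (hermitianPair A) := by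
  rw [mem_formUnitaryGroup_hermitianPair_iff, Matrix.GeneralLinearGroup.val_mk'', liftMatrix_map_fst,
    liftMatrix_map_snd, transpose_transpose, Matrix.mul_assoc (A * g₁⁻¹), Matrix.mul_assoc A,
    Matrix.nonsing_inv_mul A hA, Matrix.mul_one, Matrix.mul_assoc, Matrix.nonsing_inv_mul g₁ h₁, Matrix.mul_one]

include hA in
/-- An isometry `g` of `(A, Aᵀ)` is `liftMatrix A g₁` for its first component `g₁` (file 144's
`snd_eq_of_isometry`). -/
theorem eq_liftMatrix_of_mem (g : GL n (F × F))
    (hg : letI := swapStarRing F; g ∈ formUnitaryGroup (hermitianPair A)) :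
    (g : Matrix n n (F × F)) = liftMatrix A ((g : Matrix n n (F × F)).map Prod.fst) := by
  letI := swapStarRing F
  rw [mem_formUnitaryGroup_iff] at hg
  exact ext_of_map_fst_snd (liftMatrix_map_fst A _).symm
    (by rw [liftMatrix_map_snd]; exact snd_eq_of_isometry A hA _ hg)

include hA in
/-- The first component of an isometry is invertible. -/
theorem isUnit_det_map_fst_of_mem (g : GL n (F × F))
    (hg : letI := swapStarRing F; g ∈ formUnitaryGroup (hermitianPair A)) :
    IsUnit ((g : Matrix n n (F × F)).map Prod.fst).det := by
  letI := swapStarRing F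
  rw [mem_formUnitaryGroup_iff] at hg
  exact isUnit_det_fst_of_isometry A hA _ hg

/-- **`U((A, Aᵀ)) ≅ GL_n(F)` at a split place**: the first projection is a group isomorphism from the isometry
group of `(A, Aᵀ)` over `(F × F, swap)` onto `GL_n(F)`, with inverse `g₁ ↦ (g₁, (A g₁⁻¹ A⁻¹)ᵀ)`. -/
noncomputable def splitUnitaryEquiv :
    (letI := swapStarRing F; ↥(formUnitaryGroup (hermitianPair A))) ≃* GL n F := by
  letI := swapStarRing F
  exact
    { toFun := fun g => fstGL g.1
      invFun := fun g₁ => ⟨Matrix.GeneralLinearGroup.mk'' (liftMatrix A g₁) (isUnit_det_liftMatrix A hA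
        (Matrix.isUnits_det_units g₁)), liftMatrix_mem A hA (Matrix.isUnits_det_units g₁)⟩
      left_inv := fun g => by
        apply Subtype.ext
        apply Units.ext
        rw [Matrix.GeneralLinearGroup.val_mk'', coe_fstGL]
        exact (eq_liftMatrix_of_mem A hA g.1 g.2).symm
      right_inv := fun g₁ => by
        apply Units.ext
        rw [coe_fstGL, Matrix.GeneralLinearGroup.val_mk'', liftMatrix_map_fst]
      map_mul' := fun g g' => map_mul fstGL g.1 g'.1 }

/-- `splitUnitaryEquiv` is the first projection. -/
theorem splitUnitaryEquiv_apply (g : (letI := swapStarRing F; ↥(formUnitaryGroup (hermitianPair A)))) :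
    splitUnitaryEquiv A hA g = fstGL g.1 := rfl

/-- The inverse of `splitUnitaryEquiv` has matrix `liftMatrix A g₁`. -/
theorem coe_splitUnitaryEquiv_symm (g₁ : GL n F) :
    (((splitUnitaryEquiv A hA).symm g₁).1 : Matrix n n (F × F)) = liftMatrix A (g₁ : Matrix n n F) := rfl

end Equiv

/-! ## The integral points: `K' = U ∩ GL_n(R × R)` goes to `GL_n(R)` -/

section Integral

variable {R F : Type*} [CommRing R] [CommRing F] (φ : R →+* F) {n : Type*} [Fintype n] [DecidableEq n]

/-- The integral isometries: `U((A, Aᵀ)) ∩ GL_n(R × R)` (entries and inverse entries in the image of `R × R`),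
the split-place `K_v = U(V_v) ∩ GL_n(𝒪_v × 𝒪_v)`. -/
def splitHyperspecial (A : Matrix n n F) :
    Subgroup (letI := swapStarRing F; ↥(formUnitaryGroup (hermitianPair A))) :=
  letI := swapStarRing F
  (Matrix.GeneralLinearGroup.map (φ.prodMap φ)).range.subgroupOf (formUnitaryGroup (hermitianPair A))

/-- `RingHom.fst ∘ prodMap φ φ = φ ∘ RingHom.fst` on `R × R`. -/
theorem fst_comp_prodMap : (RingHom.fst F F).comp (φ.prodMap φ) = φ.comp (RingHom.fst R R) :=
  RingHom.ext fun _ => rfl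

/-- The first projection of `GL.map (prodMap φ φ) U` is `GL.map φ` of the first component of `U`. -/
theorem fstGL_map_prodMap (U : GL n (R × R)) :
    fstGL (Matrix.GeneralLinearGroup.map (φ.prodMap φ) U) =
      Matrix.GeneralLinearGroup.map φ (Matrix.GeneralLinearGroup.map (RingHom.fst R R) U) := by
  apply Units.ext
  change ((U : Matrix n n (R × R)).map (φ.prodMap φ)).map (RingHom.fst F F) =
    ((U : Matrix n n (R × R)).map (RingHom.fst R R)).map φ
  rw [Matrix.map_map, Matrix.map_map]
  rfl

omit [Fintype n] [DecidableEq n] in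
/-- The matrix `pairMatrix M N` read through `prodMap φ φ` is `pairMatrix (M.map φ) (N.map φ)`. -/
theorem pairMatrix_map_prodMap (M N : Matrix n n R) :
    (pairMatrix M N).map (φ.prodMap φ) = pairMatrix (M.map φ) (N.map φ) := by
  ext i j <;> rfl

omit [DecidableEq n] in
/-- `pairMatrix` is multiplicative. -/
theorem pairMatrix_mul (M N M' N' : Matrix n n F) :
    pairMatrix M N * pairMatrix M' N' = pairMatrix (M * M') (N * N') :=
  ext_of_map_fst_snd (by rw [map_fst_mul, pairMatrix_map_fst, pairMatrix_map_fst, pairMatrix_map_fst])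
    (by rw [map_snd_mul, pairMatrix_map_snd, pairMatrix_map_snd, pairMatrix_map_snd])

omit [Fintype n] in
/-- `pairMatrix 1 1 = 1`. -/
theorem pairMatrix_one : pairMatrix (1 : Matrix n n F) 1 = 1 :=
  ext_of_map_fst_snd (by rw [pairMatrix_map_fst]; exact (Matrix.map_one _ rfl rfl).symm)
    (by rw [pairMatrix_map_snd]; exact (Matrix.map_one _ rfl rfl).symm)

variable (A₀ : Matrix n n R) (hA₀ : IsUnit A₀.det)

include hA₀ in
/-- `A₀.map φ` is invertible. -/
theorem isUnit_det_map : IsUnit (A₀.map φ).det := by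
  rw [show A₀.map φ = φ.mapMatrix A₀ from rfl, ← RingHom.map_det]
  exact hA₀.map φ

include hA₀ in
/-- The inverse of `A₀.map φ` is `A₀⁻¹.map φ`. -/
theorem inv_map : (A₀.map φ)⁻¹ = A₀⁻¹.map φ :=
  Matrix.inv_eq_right_inv (by rw [← Matrix.map_mul, Matrix.mul_nonsing_inv A₀ hA₀]; exact Matrix.map_one _ (map_zero _) (map_one _))

/-- The matrix of `GL.map φ u` is `(u : Matrix).map φ`. -/
theorem coe_GLmap (u : GL n R) :
    ((Matrix.GeneralLinearGroup.map φ u : GL n F) : Matrix n n F) = (u : Matrix n n R).map φ := rfl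

/-- The inverse of `(GL.map φ u : Matrix)` is `(u⁻¹ : Matrix).map φ`. -/
theorem inv_coe_map (u : GL n R) :
    ((Matrix.GeneralLinearGroup.map φ u : GL n F) : Matrix n n F)⁻¹ = ((u⁻¹ : GL n R) : Matrix n n R).map φ :=
  Matrix.inv_eq_right_inv (by
    change (u : Matrix n n R).map φ * ((u⁻¹ : GL n R) : Matrix n n R).map φ = 1
    rw [← Matrix.map_mul, Units.mul_inv]; exact Matrix.map_one _ (map_zero _) (map_one _))

include hA₀ in
/-- **THE ISOMORPHISM CARRIES `K_v` ONTO `GL_n(𝒪_v)`**: for `A = A₀.map φ` with `A₀ ∈ GL_n(R)`, an isometry `g`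
of `(A, Aᵀ)` has `fstGL g ∈ GL_n(R)` iff `g ∈ U ∩ GL_n(R × R)` — the hypothesis of seat p8's T5-107. -/
theorem splitUnitaryEquiv_mem_range_iff
    (g : (letI := swapStarRing F; ↥(formUnitaryGroup (hermitianPair (A₀.map φ))))) :
    splitUnitaryEquiv (A₀.map φ) (isUnit_det_map φ A₀ hA₀) g ∈
        (Matrix.GeneralLinearGroup.map φ).range ↔ g ∈ splitHyperspecial φ (A₀.map φ) := by
  letI := swapStarRing F
  rw [splitUnitaryEquiv_apply, splitHyperspecial, Subgroup.mem_subgroupOf, MonoidHom.mem_range,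
    MonoidHom.mem_range]
  constructor
  · rintro ⟨u, hu⟩
    -- the second component `(A₀ u⁻¹ A₀⁻¹)ᵀ` is integral too
    refine ⟨⟨pairMatrix (u : Matrix n n R) (A₀ * ((u⁻¹ : GL n R) : Matrix n n R) * A₀⁻¹)ᵀ,
      pairMatrix ((u⁻¹ : GL n R) : Matrix n n R) (A₀ * (u : Matrix n n R) * A₀⁻¹)ᵀ, ?_, ?_⟩, ?_⟩
    · rw [pairMatrix_mul, Units.mul_inv, ← transpose_mul]
      simp only [Matrix.mul_assoc]
      rw [Matrix.nonsing_inv_mul_cancel_left A₀ _ hA₀, Units.mul_inv_cancel_left, Matrix.mul_nonsing_inv A₀ hA₀,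
        transpose_one, pairMatrix_one]
    · rw [pairMatrix_mul, Units.inv_mul, ← transpose_mul]
      simp only [Matrix.mul_assoc]
      rw [Matrix.nonsing_inv_mul_cancel_left A₀ _ hA₀, Units.inv_mul_cancel_left, Matrix.mul_nonsing_inv A₀ hA₀,
        transpose_one, pairMatrix_one]
    · apply Units.ext
      rw [eq_liftMatrix_of_mem (A₀.map φ) (isUnit_det_map φ A₀ hA₀) g.1 g.2]
      change (pairMatrix (u : Matrix n n R) (A₀ * ((u⁻¹ : GL n R) : Matrix n n R) * A₀⁻¹)ᵀ).map (φ.prodMap φ) = _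
      rw [pairMatrix_map_prodMap, liftMatrix, ← coe_fstGL, ← hu, transpose_map, Matrix.map_mul, Matrix.map_mul,
        inv_coe_map, inv_map φ A₀ hA₀, coe_GLmap]
  · rintro ⟨U, hU⟩
    refine ⟨Matrix.GeneralLinearGroup.map (RingHom.fst R R) U, ?_⟩
    rw [← fstGL_map_prodMap, hU]

end Integral

/-! ## The spherical Hecke algebra of the split unitary group is commutative -/

section Hecke

variable {R F : Type*} [CommRing R] [IsDomain R] [Field F] [Algebra R F] [IsFractionRing R F]
  [IsDiscreteValuationRing R] [Finite (IsLocalRing.ResidueField R)]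
  {n : Type*} [Fintype n] [DecidableEq n]

/-- **THE SPLIT HALF OF «`H(U(V_v), K_v)` IS COMMUTATIVE»**: for `R` a DVR with finite residue field, `F` its
fraction field, and `A₀ ∈ GL_n(R)`, the Hecke algebra of `U((A₀, A₀ᵀ))` over `(F × F, swap)` with respect to its
integral points `U ∩ GL_n(R × R)` is commutative (seat p8's T5-107 on `splitUnitaryEquiv`). -/
theorem heckeAlgebra_mul_comm_split (k : Type*) [Field k] (A₀ : Matrix n n R) (hA₀ : IsUnit A₀.det)
    (T S : T5HeckePermutationModule.heckeAlgebra k (splitHyperspecial (algebraMap R F) (A₀.map (algebraMap R F)))) :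
    T * S = S * T :=
  T5SplitPlaceHecke.heckeAlgebra_mul_comm_of_equiv k
    (splitUnitaryEquiv (A₀.map (algebraMap R F)) (isUnit_det_map _ A₀ hA₀))
    (fun g => splitUnitaryEquiv_mem_range_iff (algebraMap R F) A₀ hA₀ g) T S

end Hecke

end Summit.Ventures.HodgeRepro2.T5SplitUnitaryGroupEquiv
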